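import Mathlib
import Literature.MathematicalPhysics.QuantumFieldTheory.Balaban1983to89.B6QGQDecay237

/-!
# Bałaban [B5] (1.103) p. 34 — the operator `H = G Q*(Q G Q*)⁻¹` ON THE WHOLE LATTICE `ℤ^d`, scalar case:
# existence as an absolutely convergent kernel, `Q H = I`, the Euler–Lagrange identity, local minimality,
# `H·1 = 1`, and mesh-free decay

**Sources (verbatim; the quotations LOCATE the object — nothing printed is used as a hypothesis).**

* [B5] T. Bałaban, *Propagators and renormalization transformations for lattice gauge theories. I*, Commun. Math.
  Phys. **95** (1984) 17–40 [`Balaban1984PropagatorsI`], p. 34 [PDF 18] (render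
  `1984-cmp95-propagators-rt-I-p018-x2.png`, read as an image by this unit): «The condition QA = B gives the equation
  −QGQ*ω = B, −ω = (QGQ*)⁻¹B, (1.102) so finally we get the representation H_kB = GQ*(QGQ*)⁻¹B. (1.103) This
  representation allows us to reduce a proof of properties of H_k to the corresponding properties of G.»; and p. 29
  [PDF 13] (render `1984-cmp95-propagators-rt-I-p013-x2.png`, read as an image by this unit): «Using (1.60), or better
  (1.63), we can verify all the properties of H_kB: Q_kH_kB = B, R∂*H_kB = 0, H_kB is a minimum of ½⟨∂A, ∂A⟩ on the
  hyperplane {A : Q_kA = B, R∂*A = 0}, which means that ⟨∂A′, ∂H_kB⟩ = 0 on the subspace {A′ : Q_kA′ = 0, R∂*A′ = 0}.»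
  (the tree transcription `B5.HkPropsPrinted` renders the print's «hyperplane» / «subspace» as «set» — immaterial).
* [B6] T. Bałaban, *Propagators and renormalization transformations for lattice gauge theories. II*, Commun. Math.
  Phys. **96** (1984) 223–250 [`Balaban1984PropagatorsII`], p. 236 (2.74)–(2.76): «G'_j denotes the operator
  (Δ^{L^{−j}} + a_jQ'_j*Q'_j)^{−1} on the whole lattice L^{−j}Z^d» and «it follows that Q'_jG'_jQ'_j* ≥ 2γ₀;»
  (kernel-certified in the scalar case by `B6QGQLower276`, `B6QGQDecay237`, with our constants).
* [B4] T. Bałaban, *Regularity and decay of lattice Green's functions*, Commun. Math. Phys. **89** (1983) 571–597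
  [`Balaban1983RegularityDecay`], Sect. 5 Theorem p. 594 (5.6) ⟹ (5.7) (tree: `B4Sect5Exhaustion`, `B4Sect5L2`).

**What this module proves (KERNEL, hypothesis-free; scalar case `U = 1`; site coordinates on `ℤ^d`, mesh
`η = 1/(n+1)` with `n : ℕ` ARBITRARY, `a > 0`; ALL constants are functions of `d` and `a` only).**  With
`G' = (Δ^η + aQ'*Q')⁻¹` on the whole lattice (`Gk n a p q = limInv ℤ^d (Aker n a)`), `(Q'G'Q'*)⁻¹` on the whole unit
lattice (`Kinv n a = limInv ℤ^d (KerQGQ n a)`, which exists by `B6QGQDecay237.hyp56Z_KerQGQ_unif`) and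
`(G'Q'*)(p,y') = Σ_{q∈B(y')} G'(p,q)` (`gq`):

1. `kerH n a p y := Σ'_{y'∈ℤ^d} (G'Q'*)(p,y')·(Q'G'Q'*)⁻¹(y',y)` — **the kernel of `H = G'Q'*(Q'G'Q'*)⁻¹` of (1.103) on
   `ℤ^d`**, an ABSOLUTELY CONVERGENT series (`summable_kerH`; `sum_mul_kerH`: finite sums pass inside);
2. `abs_sum_mul_kerH_le` — **mesh-free decay** in the `η^d`-weighted `ℓ²` reading:
   `|Σ_{p∈B(y″)} v(p)H(p,y)| ≤ c_H (n+1)^{d/2} e^{−δ_H|y″−y|_∞} (Σ_{B(y″)}v²)^{1/2}`, whence the pointwise bound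
   `abs_kerH_le` (`|H(p,y)| ≤ c_H (n+1)^{d/2} e^{−δ_H|blk p−y|_∞}`) and the MESH-FREE block-RMS bound `kerH_blockRMS_le`
   (`((n+1)^{−d}Σ_{p∈B(y″)}H(p,y)²)^{1/2} ≤ c_H e^{−δ_H|y″−y|_∞}`), `c_H = cH d a`, `δ_H = deltaH d a = min(δ_u,δ_inv)/2`;
3. `blockAvg_kerH` — **`Q'H = I`**: `(n+1)^{−d}Σ_{p∈B(y″)} H(p,y) = δ_{y″y}` («Q_kH_kB = B»);
4. `tsum_AX_mul_kerH` — **the Euler–Lagrange identity `(Δ^η + aQ'*Q')H = Q'*(Q'G'Q'*)⁻¹`**: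
   `Σ_r A(p,r)H(r,y) = (Q'G'Q'*)⁻¹(blk p, y)`; and `tsum_lap_mul_kerH` — **`Δ^η H = Q'*Φ`, `Φ = (Q'G'Q'*)⁻¹ − a·I`**:
   `Σ_r (n+1)²(−Δ)(p,r)H(r,y) = (Q'G'Q'*)⁻¹(blk p,y) − aδ_{blk p,y}`, i.e. `H(·,y)` is discrete-harmonic modulo block
   constants — the constrained-minimiser (Lagrange multiplier) equation of «H_kB is a minimum of ½⟨∂A, ∂A⟩ on the
   hyperplane {A : Q_kA = B, R∂*A = 0}» in the scalar analogue;
5. the row identities behind 4.: `sum_AX_mul_Gk` (`AG' = I` entrywise on `ℤ^d`), `sum_AX_mul_gq` (`A(G'Q'*) = Q'*`);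
6. `weakEL_kerH` — **the weak Euler–Lagrange equation** «⟨∂A′, ∂H_kB⟩ = 0 on the subspace {A′ : Q_kA′ = 0,
   R∂*A′ = 0}» in the scalar analogue: `⟨Δ^ηA', H(·,y)⟩ = 0` for every finitely supported `A'` with `Q'A' = 0`;
7. `abs_sum_sum_kerH_le` — **`H : ℓ²(ℤ^d) → ℓ²_η` is bounded uniformly in the mesh with exponential off-diagonal
   decay**: `|⟨v, Hw⟩| ≤ c_H K_d(δ_H/2) (n+1)^{d/2} e^{−(δ_H/2)R} ‖v‖_{ℓ²} ‖w‖_{ℓ²}` for sources and targets at block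
   distance `≥ R` (finite Schur test `schur_finset`);
8. `energy_kerH_add` / `energy_kerH_le` — **local minimality of the Dirichlet energy** («H_kB is a minimum of
   ½⟨∂A, ∂A⟩ on the hyperplane {A : Q_kA = B, R∂*A = 0}», scalar analogue, finite-energy perturbations): for every
   finitely supported `A'` with `Q'A' = 0`, `E_win(H(·,y) + A') = E_win(H(·,y)) + E_win(A')`, where `E_win` is the
   sum of squared bond differences over the bond window `win S ⊇` every bond meeting `supp A'` (outside it the two
   energy densities coincide,
   `eq_zero_off_win`); tools: the three-point row formula `tsum_lapKer_mul`, summation by parts `sbp_window`,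
   `bondPairing_kerH_eq_zero` (`∂H(·,y) ⊥ ∂A'`), `sum_mul_blockConst_eq_zero`;
9. `tsum_kerH_row` — **reproduction of constants `H·1 = 1`**: `Σ'_y H(p,y) = 1` for every `p ∈ ℤ^d`, through the
   row-sum identities `tsum_AX_row` (`A·1 = a`), `tsum_Gk_row` (`G'·1 = a⁻¹`), `tsum_kerQGQ_row`
   (`(Q'G'Q'*)·1 = a⁻¹`), `tsum_Kinv_row` (`(Q'G'Q'*)⁻¹·1 = a`), the entrywise identities `tsum_Gk_mul_AX`
   (`G'A = I`), `tsum_Kinv_mul_kerQGQ` (`(Q'G'Q'*)⁻¹(Q'G'Q'*) = I`) and Fubini for lattice kernels with exponential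
   majorants (`summable_uncurry_of_majorant`, `tsum_mul_tsum_comm`, block-by-block summation `tsum_blocks`).

DICTIONARY (as in `B6QGQLower276`/`B6QGQDecay237`, honest): fine field `f : ℤ^d → ℝ` on the `η`-lattice in SITE
coordinates; `Q'f(y) = (n+1)^{−d}Σ_{p∈B(y)}f(p)` (block average), `Q'*ω = ω ∘ blk` (adjoint for the `η^d`-weighted fine
and unit-weighted coarse scalar products); `Δ^η + aQ'*Q'` has site matrix `AX n a`; `G'`, `Q'G'Q'*`, `(Q'G'Q'*)⁻¹` are the
B4 Sect. 5 kernels `limInv`; `H` acts by `(HB)(p) = Σ_y H(p,y)B(y)`.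

HONEST SCOPE.  (i) SCALAR analogue only: the printed `H_k` of [B5] acts on VECTOR fields (1-forms) with the axial-gauge
averaging `Q_k` of (1.16) and the gauge condition `R∂*A = 0`; in the scalar analogue the gauge terms are absent and
`Q'` is plain block averaging — this module certifies the scalar object, not the printed one.  (ii) The setting is the
WHOLE lattice `ℤ^d` (the print's torus `T_η` is not treated).  (iii) The decay is in the `ℓ²` (block-to-point /
block-RMS) form with the factor `(n+1)^{d/2} = η^{−d/2}` at a point source; NO sup-norm `O(1)` entry bound for `H(p,y)`
is claimed (that needs elliptic regularity, cf. WALL ruling (R14-6)).  (iv) Constants `c_H, δ_H` are ours (functions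
of `d, a`), not the print's.  (v) Uniqueness / `a`-independence of `H` are not
formalised beyond the LOCAL minimality of §8 (finite-energy perturbations) — global uniqueness and `a`-independence
of `H` are not claimed.

ABSOLUTE-RULE CENSUS: every theorem below is proved outright from the tree modules `B6QGQDecay237`, `B6QGQLower276`,
`B4Sect5Exhaustion`, `B4Sect5L2`, `B4Sect5Proof` and Mathlib (sorry-free; axioms `propext`, `Classical.choice`,
`Quot.sound` only); no quoted statement is used as a hypothesis.  Unit `b2b-balaban-pv23-g7` (surge node prover
#23, gen 7; journal claim B5-103-HK-SCALAR-ZD); value = kernel discharge of the scalar half of WALL v2.2 §9 row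
«B5 (1.99)–(1.103)» («the infinite-volume operator»), NOT summit progress.
-/

namespace Literature.MathematicalPhysics.QuantumFieldTheory.Balaban1983to89.B5Hk103ScalarZd

open Finset Real Filter Topology
open B4Sect5Exhaustion B4Sect5L2 B6QGQLower276 B6QGQDecay237
open B4Sect5Proof (cStar deltaStar cStar_pos deltaStar_pos latticeConst latticeSum_le latticeConst_nonneg)

noncomputable section

variable {d : ℕ}

/-! ## §1  The kernels: `G'`, `(Q'G'Q'*)⁻¹`, `G'Q'*` and `H = G'Q'*(Q'G'Q'*)⁻¹` [folklore dictionary] -/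

/-- `G'(p,q)`: the B4 Sect. 5 inverse kernel of the site matrix `Δ^η + aQ'*Q'` (`B6QGQLower276.Aker n a`) on the WHOLE
lattice `ℤ^d` (`η = 1/(n+1)`, site coordinates). [folklore] -/
def Gk (n : ℕ) (a : ℝ) (p q : X d) : ℝ := limInv Set.univ (Aker n a) (p, 0) (q, 0)

/-- `(Q'G'Q'*)⁻¹(y,y')`: the B4 Sect. 5 inverse kernel of the unit-lattice matrix `Q'G'Q'*` (`B6QGQLower276.KerQGQ n a`)
on the whole unit lattice `ℤ^d`. [folklore] -/
def Kinv (n : ℕ) (a : ℝ) (y y' : X d) : ℝ := limInv Set.univ (KerQGQ n a) (y, 0) (y', 0)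

/-- The kernel of `G'Q'*` (fine site `p`, block `y'`): `(G'Q'*)(p,y') = Σ_{q ∈ B(y')} G'(p,q)` (`Q'*ω = ω ∘ blk`). [folklore] -/
def gq (n : ℕ) (a : ℝ) (p y' : X d) : ℝ := ∑ q ∈ B n y', Gk n a p q

/-- **B5 (1.103), scalar case, on `ℤ^d`: the kernel of `H = G'Q'*(Q'G'Q'*)⁻¹`** (fine site `p`, block `y`):
`H(p,y) = Σ'_{y' ∈ ℤ^d} (G'Q'*)(p,y') · (Q'G'Q'*)⁻¹(y',y)` — an absolutely convergent series (`summable_kerH`).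
[cite: Balaban1984PropagatorsI, (1.103) p.34] -/
def kerH (n : ℕ) (a : ℝ) (p y : X d) : ℝ := ∑' y' : X d, gq n a p y' * Kinv n a y' y

/-- The identification `ℤ^d ≃ ℤ^d × Fin 1` of the scalar (`N = 1`) B4 index set with the lattice. [folklore] -/
def toK : X d ≃ K d 1 where
  toFun y := (y, 0)
  invFun q := q.1
  left_inv _ := rfl
  right_inv q := Prod.ext rfl (Fin.fin_one_eq_zero q.2).symm

/-! ## §2  Exponentially weighted lattice sums on `ℤ^d` [folklore] -/

/-- `y ↦ e^{−b|x−y|_∞}` is summable over `ℤ^d` (`b > 0`). [folklore] -/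
theorem summable_expX {b : ℝ} (hb : 0 < b) (x : X d) :
    Summable fun y : X d => Real.exp (-(b * dist x y)) :=
  summable_of_sum_le (fun _ => (Real.exp_pos _).le) (fun s => latticeSum_le d hb s x)

/-- `Σ'_{y ∈ ℤ^d} e^{−b|x−y|_∞} ≤ K_d(b) = (2(1 − e^{−b/d})⁻¹)^d`. [folklore] -/
theorem tsum_expX_le {b : ℝ} (hb : 0 < b) (x : X d) :
    ∑' y : X d, Real.exp (-(b * dist x y)) ≤ latticeConst d b :=
  (summable_expX hb x).tsum_le_of_sum_le (fun s => latticeSum_le d hb s x)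

/-- The mesh rescaling of a block-separated distance: `e^{−δ((n+1)D − n)/(n+1)} ≤ e^{δ}·e^{−δD}` (`δ ≥ 0`). [folklore] -/
theorem exp_rescale_le (n : ℕ) {δ : ℝ} (hδ : 0 ≤ δ) (D : ℝ) :
    Real.exp (-(δ * ((((n : ℝ) + 1) * D - n) / ((n : ℝ) + 1)))) ≤ Real.exp δ * Real.exp (-(δ * D)) := by
  rw [← Real.exp_add]
  apply Real.exp_le_exp.2
  have hn1 : (0 : ℝ) < (n : ℝ) + 1 := by positivity
  have h1 : (((n : ℝ) + 1) * D - n) / ((n : ℝ) + 1) = D - n / ((n : ℝ) + 1) := by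
    field_simp
  have h2 : (n : ℝ) / ((n : ℝ) + 1) ≤ 1 := by
    rw [div_le_one hn1]; linarith
  rw [h1]
  nlinarith

/-- Splitting two exponential factors along a triangle inequality `D ≤ D₁ + D₂`:
`e^{−δ_uD₁}e^{−δ_ID₂} ≤ e^{−(min(δ_u,δ_I)/2)·D} · e^{−(δ_I/2)D₂}` (`D₁, D₂ ≥ 0`). [folklore] -/
theorem exp_split_triangle {δu δI D₁ D₂ D : ℝ} (hu : 0 ≤ δu) (hI : 0 ≤ δI) (h1 : 0 ≤ D₁) (h2 : 0 ≤ D₂)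
    (hD : D ≤ D₁ + D₂) :
    Real.exp (-(δu * D₁)) * Real.exp (-(δI * D₂))
      ≤ Real.exp (-(min δu δI / 2 * D)) * Real.exp (-(δI / 2 * D₂)) := by
  rw [← Real.exp_add, ← Real.exp_add]
  apply Real.exp_le_exp.2
  have hm1 : min δu δI ≤ δu := min_le_left _ _
  have hm2 : min δu δI ≤ δI := min_le_right _ _
  have hm0 : 0 ≤ min δu δI := le_min hu hI
  have h3 : min δu δI / 2 * D ≤ min δu δI / 2 * (D₁ + D₂) :=
    mul_le_mul_of_nonneg_left hD (by positivity)
  nlinarith [mul_nonneg hu h1, mul_nonneg hI h2, mul_le_mul_of_nonneg_right hm1 h1,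
    mul_le_mul_of_nonneg_right hm2 h2]

/-! ## §3  Entry bounds for the factors (from `B6QGQDecay237`) and absolute convergence of the kernel of `H` -/

/-- `|G'(p,q)| ≤ (2/min(2,a)) e^{−δ_u|p−q|_∞/(n+1)}` on the whole lattice. [cite: Balaban1983RegularityDecay, (1.10) p.573] -/
theorem abs_Gk_le (n : ℕ) {a : ℝ} (ha : 0 < a) (p q : X d) :
    |Gk n a p q| ≤ 2 / min 2 a * Real.exp (-(deltaU d a * (dist p q / ((n : ℝ) + 1)))) :=
  gPrime_entry_decay n ha Set.univ (Set.mem_univ p) (Set.mem_univ q)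

/-- `|(Q'G'Q'*)⁻¹(y,y')| ≤ c_inv(d,a) e^{−δ_inv(d,a)|y−y'|_∞}` on the whole unit lattice.
[cite: Balaban1983RegularityDecay, (5.7) p.594] -/
theorem abs_Kinv_le (n : ℕ) {a : ℝ} (ha : 0 < a) (y y' : X d) :
    |Kinv n a y y'| ≤ cInv d a * Real.exp (-(deltaInv d a * dist y y')) :=
  qGqInv_decay_unif n ha Set.univ y y'

/-- **Block-to-block bound for `G'Q'*`** (the `ℓ²` Combes–Thomas bound of `B6QGQDecay237.gPrime_setDecay` with the
indicator of the block `B(y')` as second test function): for every `v`,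
`|Σ_{p∈B(y″)} v(p)(G'Q'*)(p,y')| ≤ c_u e^{−δ_u|y″−y'|_∞} · (Σ_{B(y″)} v²)^{1/2} · (n+1)^{d/2}`. [folklore] -/
theorem abs_sum_mul_gq_le (n : ℕ) {a : ℝ} (ha : 0 < a) (y'' y' : X d) (v : X d → ℝ) :
    |∑ p ∈ B n y'', v p * gq n a p y'|
      ≤ cU d a * Real.exp (-(deltaU d a * dist y'' y'))
        * Real.sqrt (∑ p ∈ B n y'', v p ^ 2) * Real.sqrt (((n : ℝ) + 1) ^ d) := by
  have h := gPrime_setDecay n ha Set.univ (B n y'') (B n y') (Set.subset_univ _) (Set.subset_univ _)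
    (((n : ℝ) + 1) * dist y'' y' - n) (fun p hp q hq => dist_blk_ge hp hq) v (fun _ => 1)
  have hL : ∑ p ∈ B n y'', ∑ q ∈ B n y', v p * limInv Set.univ (Aker n a) (p, 0) (q, 0) * 1
      = ∑ p ∈ B n y'', v p * gq n a p y' := by
    refine Finset.sum_congr rfl fun p _ => ?_
    rw [gq, Finset.mul_sum]
    refine Finset.sum_congr rfl fun q _ => ?_
    rw [mul_one, Gk]
  have hR : ∑ q ∈ B n y', ((fun _ => (1 : ℝ)) q) ^ 2 = ((n : ℝ) + 1) ^ d := by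
    simp only [one_pow, sum_B_const, mul_one]
  rw [hL, hR] at h
  refine h.trans ?_
  have hexp := exp_rescale_le n (deltaU_pos d ha).le (dist y'' y')
  have hs1 : 0 ≤ Real.sqrt (∑ p ∈ B n y'', v p ^ 2) := Real.sqrt_nonneg _
  have hs2 : 0 ≤ Real.sqrt (((n : ℝ) + 1) ^ d) := Real.sqrt_nonneg _
  have hσ : 0 < 2 / min 2 a := div_pos two_pos (lt_min two_pos ha)
  calc 2 / min 2 a * Real.exp (-(deltaU d a * ((((n : ℝ) + 1) * dist y'' y' - n) / ((n : ℝ) + 1))))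
        * Real.sqrt (∑ p ∈ B n y'', v p ^ 2) * Real.sqrt (((n : ℝ) + 1) ^ d)
      ≤ 2 / min 2 a * (Real.exp (deltaU d a) * Real.exp (-(deltaU d a * dist y'' y')))
        * Real.sqrt (∑ p ∈ B n y'', v p ^ 2) * Real.sqrt (((n : ℝ) + 1) ^ d) := by
        gcongr
    _ = cU d a * Real.exp (-(deltaU d a * dist y'' y'))
        * Real.sqrt (∑ p ∈ B n y'', v p ^ 2) * Real.sqrt (((n : ℝ) + 1) ^ d) := by
        rw [cU]; ring

/-- Entry bound for `G'Q'*`: `|(G'Q'*)(p,y')| ≤ c_u (n+1)^{d/2} e^{−δ_u|blk p − y'|_∞}`. [folklore] -/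
theorem abs_gq_le (n : ℕ) {a : ℝ} (ha : 0 < a) (p y' : X d) :
    |gq n a p y'| ≤ cU d a * Real.sqrt (((n : ℝ) + 1) ^ d) * Real.exp (-(deltaU d a * dist (blk n p) y')) := by
  classical
  have hp : p ∈ B n (blk n p) := mem_B.2 rfl
  have h := abs_sum_mul_gq_le n ha (blk n p) y' (fun q => if q = p then 1 else 0)
  have hL : ∑ q ∈ B n (blk n p), (if q = p then (1 : ℝ) else 0) * gq n a q y' = gq n a p y' := by
    simp [ite_mul, Finset.sum_ite_eq', hp]
  have hR : ∑ q ∈ B n (blk n p), (if q = p then (1 : ℝ) else 0) ^ 2 = 1 := by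
    simp [Finset.sum_ite_eq', hp]
  rw [hL, hR, Real.sqrt_one, mul_one] at h
  linarith

/-- **Absolute convergence of the series defining `H(p,y)`**: the terms are dominated by
`c_u c_inv (n+1)^{d/2} · e^{−δ_inv|y−y'|_∞}`, summable over `y' ∈ ℤ^d`. [folklore] -/
theorem summable_kerH (n : ℕ) {a : ℝ} (ha : 0 < a) (p y : X d) :
    Summable fun y' : X d => gq n a p y' * Kinv n a y' y := by
  refine Summable.of_norm_bounded
    ((summable_expX (deltaInv_pos d ha) y).mul_left (cU d a * Real.sqrt (((n : ℝ) + 1) ^ d) * cInv d a))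
    fun y' => ?_
  rw [Real.norm_eq_abs, abs_mul]
  have h1 := abs_gq_le n ha p y'
  have h2 := abs_Kinv_le n ha y' y
  have hcU : 0 < cU d a := cU_pos d ha
  have hcI : 0 < cInv d a := cInv_pos d ha
  have he1 : Real.exp (-(deltaU d a * dist (blk n p) y')) ≤ 1 := by
    rw [Real.exp_le_one_iff, neg_nonpos]
    exact mul_nonneg (deltaU_pos d ha).le dist_nonneg
  have h1' : |gq n a p y'| ≤ cU d a * Real.sqrt (((n : ℝ) + 1) ^ d) := by
    refine h1.trans ?_
    have : 0 ≤ cU d a * Real.sqrt (((n : ℝ) + 1) ^ d) := by positivity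
    nlinarith
  rw [dist_comm] at h2
  calc |gq n a p y'| * |Kinv n a y' y|
      ≤ (cU d a * Real.sqrt (((n : ℝ) + 1) ^ d)) * (cInv d a * Real.exp (-(deltaInv d a * dist y y'))) :=
        mul_le_mul h1' h2 (abs_nonneg _) (by positivity)
    _ = cU d a * Real.sqrt (((n : ℝ) + 1) ^ d) * cInv d a * Real.exp (-(deltaInv d a * dist y y')) := by
        ring

/-- Finite sums against the kernel of `H` may be taken inside the series:
`Σ_{p∈S} v(p)H(p,y) = Σ'_{y'} (Σ_{p∈S} v(p)(G'Q'*)(p,y')) (Q'G'Q'*)⁻¹(y',y)`. [folklore] -/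
theorem sum_mul_kerH (n : ℕ) {a : ℝ} (ha : 0 < a) (S : Finset (X d)) (v : X d → ℝ) (y : X d) :
    ∑ p ∈ S, v p * kerH n a p y = ∑' y' : X d, (∑ p ∈ S, v p * gq n a p y') * Kinv n a y' y := by
  have hs : ∀ p ∈ S, Summable fun y' : X d => v p * (gq n a p y' * Kinv n a y' y) :=
    fun p _ => (summable_kerH n ha p y).mul_left (v p)
  calc ∑ p ∈ S, v p * kerH n a p y
      = ∑ p ∈ S, ∑' y' : X d, v p * (gq n a p y' * Kinv n a y' y) := by
        refine Finset.sum_congr rfl fun p _ => ?_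
        rw [kerH, tsum_mul_left]
    _ = ∑' y' : X d, ∑ p ∈ S, v p * (gq n a p y' * Kinv n a y' y) := (Summable.tsum_finsetSum hs).symm
    _ = ∑' y' : X d, (∑ p ∈ S, v p * gq n a p y') * Kinv n a y' y := by
        refine tsum_congr fun y' => ?_
        rw [Finset.sum_mul]
        refine Finset.sum_congr rfl fun p _ => ?_
        ring

/-! ## §4  Mesh-free exponential decay of `H` in the block distance -/

/-- The decay rate of `H`: `δ_H(d,a) = min(δ_u, δ_inv)/2`. [folklore] -/
def deltaH (d : ℕ) (a : ℝ) : ℝ := min (deltaU d a) (deltaInv d a) / 2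

/-- The constant of `H`: `c_H(d,a) = c_u · c_inv · K_d(δ_inv/2)`. [folklore] -/
def cH (d : ℕ) (a : ℝ) : ℝ := cU d a * cInv d a * latticeConst d (deltaInv d a / 2)

/-- `δ_H > 0`. [folklore] -/
theorem deltaH_pos (d : ℕ) {a : ℝ} (ha : 0 < a) : 0 < deltaH d a := by
  unfold deltaH
  exact div_pos (lt_min (deltaU_pos d ha) (deltaInv_pos d ha)) two_pos

/-- `c_H > 0`. [folklore] -/
theorem cH_pos (d : ℕ) {a : ℝ} (ha : 0 < a) : 0 < cH d a := by
  unfold cH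
  have h1 := cU_pos d ha
  have h2 := cInv_pos d ha
  have h3 : 0 < latticeConst d (deltaInv d a / 2) := by
    have hb : 0 < deltaInv d a / 2 := div_pos (deltaInv_pos d ha) two_pos
    unfold latticeConst
    rcases Nat.eq_zero_or_pos d with hd | hd
    · subst hd; simp
    · have hlt : Real.exp (-(deltaInv d a / 2 / d)) < 1 :=
        Real.exp_lt_one_iff.mpr (neg_lt_zero.2 (div_pos hb (by exact_mod_cast hd)))
      apply pow_pos
      apply mul_pos two_pos
      apply inv_pos.2
      linarith
  positivity

/-- **THE DECAY OF `H` (mesh-free, block-to-point `ℓ²` form).**  For every block `y″`, every unit-lattice point `y`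
and every fine test function `v`:
`|Σ_{p∈B(y″)} v(p) H(p,y)| ≤ c_H(d,a) (n+1)^{d/2} e^{−δ_H(d,a)|y″−y|_∞} (Σ_{B(y″)} v²)^{1/2}` — equivalently, with the
`η^d`-weighted fine scalar product `⟨v,w⟩_η = η^dΣ vw` of [B5]/[B6], `|⟨v, H δ_y⟩_η| ≤ c_H e^{−δ_H|y″−y|}‖v‖_η`, with ALL
constants functions of `d` and `a` only (uniform in the mesh `η = 1/(n+1)`). [cite: Balaban1984PropagatorsI, (1.103) p.34] -/
theorem abs_sum_mul_kerH_le (n : ℕ) {a : ℝ} (ha : 0 < a) (y'' y : X d) (v : X d → ℝ) :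
    |∑ p ∈ B n y'', v p * kerH n a p y|
      ≤ cH d a * Real.sqrt (((n : ℝ) + 1) ^ d) * Real.exp (-(deltaH d a * dist y'' y))
        * Real.sqrt (∑ p ∈ B n y'', v p ^ 2) := by
  rw [sum_mul_kerH n ha (B n y'') v y]
  set Nv := Real.sqrt (∑ p ∈ B n y'', v p ^ 2) with hNv
  set Sn := Real.sqrt (((n : ℝ) + 1) ^ d) with hSn
  set M := cU d a * cInv d a * Nv * Sn * Real.exp (-(deltaH d a * dist y'' y)) with hM
  have hNv0 : 0 ≤ Nv := Real.sqrt_nonneg _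
  have hSn0 : 0 ≤ Sn := Real.sqrt_nonneg _
  have hcU : 0 < cU d a := cU_pos d ha
  have hcI : 0 < cInv d a := cInv_pos d ha
  have hM0 : 0 ≤ M := by positivity
  have hδI2 : 0 < deltaInv d a / 2 := div_pos (deltaInv_pos d ha) two_pos
  -- termwise domination
  have hdom : ∀ y' : X d, ‖(∑ p ∈ B n y'', v p * gq n a p y') * Kinv n a y' y‖
      ≤ M * Real.exp (-(deltaInv d a / 2 * dist y y')) := by
    intro y'
    rw [Real.norm_eq_abs, abs_mul]
    have h1 := abs_sum_mul_gq_le n ha y'' y' v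
    have h2 := abs_Kinv_le n ha y' y
    have h12 : |∑ p ∈ B n y'', v p * gq n a p y'| * |Kinv n a y' y|
        ≤ (cU d a * Real.exp (-(deltaU d a * dist y'' y')) * Nv * Sn)
          * (cInv d a * Real.exp (-(deltaInv d a * dist y' y))) :=
      mul_le_mul h1 h2 (abs_nonneg _) (by positivity)
    refine h12.trans ?_
    have hpair := exp_split_triangle (deltaU_pos d ha).le (deltaInv_pos d ha).le (dist_nonneg (x := y'') (y := y'))
      (dist_nonneg (x := y') (y := y)) (dist_triangle y'' y' y)
    rw [dist_comm y' y] at hpair ⊢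
    have : (cU d a * Real.exp (-(deltaU d a * dist y'' y')) * Nv * Sn)
          * (cInv d a * Real.exp (-(deltaInv d a * dist y y')))
        = (cU d a * cInv d a * Nv * Sn) * (Real.exp (-(deltaU d a * dist y'' y'))
            * Real.exp (-(deltaInv d a * dist y y'))) := by ring
    rw [this]
    have hc0 : 0 ≤ cU d a * cInv d a * Nv * Sn := by positivity
    calc (cU d a * cInv d a * Nv * Sn) * (Real.exp (-(deltaU d a * dist y'' y'))
            * Real.exp (-(deltaInv d a * dist y y')))
        ≤ (cU d a * cInv d a * Nv * Sn) * (Real.exp (-(min (deltaU d a) (deltaInv d a) / 2 * dist y'' y))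
            * Real.exp (-(deltaInv d a / 2 * dist y y'))) := mul_le_mul_of_nonneg_left hpair hc0
      _ = M * Real.exp (-(deltaInv d a / 2 * dist y y')) := by rw [hM, deltaH]; ring
  -- sum the majorant
  have hmaj : HasSum (fun y' : X d => M * Real.exp (-(deltaInv d a / 2 * dist y y')))
      (M * ∑' y' : X d, Real.exp (-(deltaInv d a / 2 * dist y y'))) :=
    ((summable_expX hδI2 y).hasSum).mul_left M
  have hbound := tsum_of_norm_bounded hmaj hdom
  rw [Real.norm_eq_abs] at hbound
  refine hbound.trans ?_
  have hK := tsum_expX_le hδI2 y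
  calc M * ∑' y' : X d, Real.exp (-(deltaInv d a / 2 * dist y y'))
      ≤ M * latticeConst d (deltaInv d a / 2) := mul_le_mul_of_nonneg_left hK hM0
    _ = cH d a * Sn * Real.exp (-(deltaH d a * dist y'' y)) * Nv := by rw [hM, cH]; ring

/-- **Pointwise bound**: `|H(p,y)| ≤ c_H (n+1)^{d/2} e^{−δ_H|blk p − y|_∞}` (the factor `(n+1)^{d/2} = η^{−d/2}` is the
price of reading an `ℓ²` bound at a point source; cf. `kerH_blockRMS_le` for the mesh-free averaged form). [folklore] -/
theorem abs_kerH_le (n : ℕ) {a : ℝ} (ha : 0 < a) (p y : X d) :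
    |kerH n a p y| ≤ cH d a * Real.sqrt (((n : ℝ) + 1) ^ d) * Real.exp (-(deltaH d a * dist (blk n p) y)) := by
  classical
  have hp : p ∈ B n (blk n p) := mem_B.2 rfl
  have h := abs_sum_mul_kerH_le n ha (blk n p) y (fun q => if q = p then 1 else 0)
  have hL : ∑ q ∈ B n (blk n p), (if q = p then (1 : ℝ) else 0) * kerH n a q y = kerH n a p y := by
    simp [Finset.sum_ite_eq', hp]
  have hR : ∑ q ∈ B n (blk n p), (if q = p then (1 : ℝ) else 0) ^ 2 = 1 := by
    simp [Finset.sum_ite_eq', hp]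
  rw [hL, hR, Real.sqrt_one, mul_one] at h
  exact h

/-- **Block-RMS decay, mesh-free**: `((n+1)^{−d} Σ_{p∈B(y″)} H(p,y)²)^{1/2} ≤ c_H(d,a) e^{−δ_H(d,a)|y″−y|_∞}` — the
root-mean-square of `H(·,y)` over any block decays exponentially in the block distance with constants depending on
`d, a` only. [cite: Balaban1984PropagatorsI, (1.103) p.34] -/
theorem kerH_blockRMS_le (n : ℕ) {a : ℝ} (ha : 0 < a) (y'' y : X d) :
    Real.sqrt ((((n : ℝ) + 1) ^ d)⁻¹ * ∑ p ∈ B n y'', kerH n a p y ^ 2)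
      ≤ cH d a * Real.exp (-(deltaH d a * dist y'' y)) := by
  have hn : (0 : ℝ) < ((n : ℝ) + 1) ^ d := by positivity
  set T := ∑ p ∈ B n y'', kerH n a p y ^ 2 with hT
  have hT0 : 0 ≤ T := Finset.sum_nonneg fun p _ => sq_nonneg _
  have h := abs_sum_mul_kerH_le n ha y'' y (fun p => kerH n a p y)
  have hL : ∑ p ∈ B n y'', kerH n a p y * kerH n a p y = T := by
    rw [hT]; refine Finset.sum_congr rfl fun p _ => by ring
  rw [hL, abs_of_nonneg hT0] at h
  -- `T ≤ C √((n+1)^d) e^{−δD} √T` ⟹ `√T ≤ C √((n+1)^d) e^{−δD}`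
  set C := cH d a * Real.exp (-(deltaH d a * dist y'' y)) with hC
  have hC0 : 0 ≤ C := by have := cH_pos d ha; positivity
  have h' : T ≤ C * Real.sqrt (((n : ℝ) + 1) ^ d) * Real.sqrt T := by
    calc T ≤ cH d a * Real.sqrt (((n : ℝ) + 1) ^ d) * Real.exp (-(deltaH d a * dist y'' y)) * Real.sqrt T := h
      _ = C * Real.sqrt (((n : ℝ) + 1) ^ d) * Real.sqrt T := by rw [hC]; ring
  have hsT : Real.sqrt T ≤ C * Real.sqrt (((n : ℝ) + 1) ^ d) := by
    by_cases hz : Real.sqrt T = 0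
    · rw [hz]; positivity
    · have hpos : 0 < Real.sqrt T := lt_of_le_of_ne (Real.sqrt_nonneg _) (Ne.symm hz)
      have hTT : T = Real.sqrt T * Real.sqrt T := (Real.mul_self_sqrt hT0).symm
      have := h'
      rw [hTT] at this
      nlinarith
  have hsq : 0 < Real.sqrt (((n : ℝ) + 1) ^ d) := Real.sqrt_pos.2 hn
  rw [show (((n : ℝ) + 1) ^ d)⁻¹ * T = T / ((n : ℝ) + 1) ^ d by rw [div_eq_inv_mul], Real.sqrt_div hT0,
    div_le_iff₀ hsq]
  exact hsT

/-- **Finite Schur test** (bilinear form): a non-negative kernel with row sums and column sums `≤ M` satisfies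
`Σ_{i∈s}Σ_{j∈t} k(i,j) f(i) g(j) ≤ M (Σ_s f²)^{1/2} (Σ_t g²)^{1/2}` (Cauchy–Schwarz with the weights `k`). [folklore] -/
theorem schur_finset {ι κ : Type*} (s : Finset ι) (t : Finset κ) (k : ι → κ → ℝ) (hk : ∀ i j, 0 ≤ k i j)
    {M : ℝ} (hM : 0 ≤ M) (hrow : ∀ i ∈ s, ∑ j ∈ t, k i j ≤ M) (hcol : ∀ j ∈ t, ∑ i ∈ s, k i j ≤ M)
    (f : ι → ℝ) (g : κ → ℝ) :
    ∑ i ∈ s, ∑ j ∈ t, k i j * f i * g j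
      ≤ M * Real.sqrt (∑ i ∈ s, f i ^ 2) * Real.sqrt (∑ j ∈ t, g j ^ 2) := by
  set F : ι × κ → ℝ := fun x => Real.sqrt (k x.1 x.2) * f x.1 with hF
  set G : ι × κ → ℝ := fun x => Real.sqrt (k x.1 x.2) * g x.2 with hG
  have hsum : ∑ i ∈ s, ∑ j ∈ t, k i j * f i * g j = ∑ x ∈ s ×ˢ t, F x * G x := by
    rw [Finset.sum_product]
    refine Finset.sum_congr rfl fun i _ => Finset.sum_congr rfl fun j _ => ?_
    simp only [hF, hG]
    have := Real.mul_self_sqrt (hk i j)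
    calc k i j * f i * g j = (Real.sqrt (k i j) * Real.sqrt (k i j)) * f i * g j := by rw [this]
      _ = Real.sqrt (k i j) * f i * (Real.sqrt (k i j) * g j) := by ring
  have hcs := Finset.sum_mul_sq_le_sq_mul_sq (s ×ˢ t) F G
  have hF2 : ∑ x ∈ s ×ˢ t, F x ^ 2 ≤ M * ∑ i ∈ s, f i ^ 2 := by
    have : ∑ x ∈ s ×ˢ t, F x ^ 2 = ∑ i ∈ s, f i ^ 2 * ∑ j ∈ t, k i j := by
      rw [Finset.sum_product]
      refine Finset.sum_congr rfl fun i _ => ?_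
      rw [Finset.mul_sum]
      refine Finset.sum_congr rfl fun j _ => ?_
      simp only [hF]
      rw [mul_pow, Real.sq_sqrt (hk i j)]; ring
    rw [this, Finset.mul_sum]
    refine Finset.sum_le_sum fun i hi => ?_
    calc f i ^ 2 * ∑ j ∈ t, k i j ≤ f i ^ 2 * M := mul_le_mul_of_nonneg_left (hrow i hi) (sq_nonneg _)
      _ = M * f i ^ 2 := mul_comm _ _
  have hG2 : ∑ x ∈ s ×ˢ t, G x ^ 2 ≤ M * ∑ j ∈ t, g j ^ 2 := by
    have : ∑ x ∈ s ×ˢ t, G x ^ 2 = ∑ j ∈ t, g j ^ 2 * ∑ i ∈ s, k i j := by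
      rw [Finset.sum_product_right]
      refine Finset.sum_congr rfl fun j _ => ?_
      rw [Finset.mul_sum]
      refine Finset.sum_congr rfl fun i _ => ?_
      simp only [hG]
      rw [mul_pow, Real.sq_sqrt (hk i j)]; ring
    rw [this, Finset.mul_sum]
    refine Finset.sum_le_sum fun j hj => ?_
    calc g j ^ 2 * ∑ i ∈ s, k i j ≤ g j ^ 2 * M := mul_le_mul_of_nonneg_left (hcol j hj) (sq_nonneg _)
      _ = M * g j ^ 2 := mul_comm _ _
  have hA : 0 ≤ ∑ i ∈ s, f i ^ 2 := Finset.sum_nonneg fun i _ => sq_nonneg _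
  have hB : 0 ≤ ∑ j ∈ t, g j ^ 2 := Finset.sum_nonneg fun j _ => sq_nonneg _
  have hFG : (∑ x ∈ s ×ˢ t, F x * G x) ^ 2 ≤ (M * ∑ i ∈ s, f i ^ 2) * (M * ∑ j ∈ t, g j ^ 2) :=
    hcs.trans (mul_le_mul hF2 hG2 (Finset.sum_nonneg fun x _ => sq_nonneg _) (by positivity))
  have habs := Real.abs_le_sqrt hFG
  rw [hsum]
  refine (le_abs_self _).trans (habs.trans (le_of_eq ?_))
  rw [Real.sqrt_mul (by positivity), Real.sqrt_mul hM, Real.sqrt_mul hM]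
  have := Real.mul_self_sqrt hM
  calc Real.sqrt M * Real.sqrt (∑ i ∈ s, f i ^ 2) * (Real.sqrt M * Real.sqrt (∑ j ∈ t, g j ^ 2))
      = (Real.sqrt M * Real.sqrt M) * Real.sqrt (∑ i ∈ s, f i ^ 2) * Real.sqrt (∑ j ∈ t, g j ^ 2) := by ring
    _ = M * Real.sqrt (∑ i ∈ s, f i ^ 2) * Real.sqrt (∑ j ∈ t, g j ^ 2) := by rw [this]

/-- **`H` IS A BOUNDED OPERATOR `ℓ²(ℤ^d) → ℓ²_η(ηℤ^d)` UNIFORMLY IN THE MESH, WITH EXPONENTIAL OFF-DIAGONAL DECAY**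
(set-to-set form on finite sets): for coarse finite sets `T″` (source blocks), `T` (targets) at mutual `ℓ^∞`-distance
`≥ R`, and all test functions `v` (fine) and `w` (coarse),
`|Σ_{y″∈T″}Σ_{p∈B(y″)}Σ_{y∈T} v(p)H(p,y)w(y)|
   ≤ c_H K_d(δ_H/2) (n+1)^{d/2} e^{−(δ_H/2)R} (Σ_{y″∈T″}Σ_{B(y″)}v²)^{1/2}(Σ_T w²)^{1/2}`;
in the `η^d`-weighted fine norm `‖v‖_η = ((n+1)^{−d}Σv²)^{1/2}` this reads `|⟨v, Hw⟩_η| ≤ c e^{−(δ_H/2)R}‖v‖_η‖w‖` with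
`c = c_H K_d(δ_H/2)` a function of `d, a` only. [cite: Balaban1984PropagatorsI, (1.103) p.34] -/
theorem abs_sum_sum_kerH_le (n : ℕ) {a : ℝ} (ha : 0 < a) (T'' T : Finset (X d)) (R : ℝ)
    (hR : ∀ y'' ∈ T'', ∀ y ∈ T, R ≤ dist y'' y) (v w : X d → ℝ) :
    |∑ y'' ∈ T'', ∑ p ∈ B n y'', ∑ y ∈ T, v p * kerH n a p y * w y|
      ≤ cH d a * latticeConst d (deltaH d a / 2) * Real.sqrt (((n : ℝ) + 1) ^ d)
        * Real.exp (-(deltaH d a / 2 * R))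
        * Real.sqrt (∑ y'' ∈ T'', ∑ p ∈ B n y'', v p ^ 2) * Real.sqrt (∑ y ∈ T, w y ^ 2) := by
  set Sn := Real.sqrt (((n : ℝ) + 1) ^ d) with hSn
  set N : X d → ℝ := fun y'' => Real.sqrt (∑ p ∈ B n y'', v p ^ 2) with hN
  have hδ2 : 0 < deltaH d a / 2 := div_pos (deltaH_pos d ha) two_pos
  have hcH : 0 < cH d a := cH_pos d ha
  have hK : 0 ≤ latticeConst d (deltaH d a / 2) := latticeConst_nonneg d hδ2.le
  -- reorganise the triple sum: `Σ_{y″} Σ_y w(y) · (Σ_{p∈B(y″)} v(p)H(p,y))`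
  have hre : ∑ y'' ∈ T'', ∑ p ∈ B n y'', ∑ y ∈ T, v p * kerH n a p y * w y
      = ∑ y'' ∈ T'', ∑ y ∈ T, w y * ∑ p ∈ B n y'', v p * kerH n a p y := by
    refine Finset.sum_congr rfl fun y'' _ => ?_
    rw [Finset.sum_comm]
    refine Finset.sum_congr rfl fun y _ => ?_
    rw [Finset.mul_sum]
    refine Finset.sum_congr rfl fun p _ => by ring
  rw [hre]
  -- termwise bound by the block-to-point decay
  have hterm : ∀ y'' ∈ T'', ∀ y ∈ T, |w y * ∑ p ∈ B n y'', v p * kerH n a p y|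
      ≤ Real.exp (-(deltaH d a / 2 * dist y'' y)) * N y'' * |w y|
        * (cH d a * Sn * Real.exp (-(deltaH d a / 2 * R))) := by
    intro y'' hy'' y hy
    rw [abs_mul]
    have h := abs_sum_mul_kerH_le n ha y'' y v
    have hsplit : Real.exp (-(deltaH d a * dist y'' y))
        ≤ Real.exp (-(deltaH d a / 2 * R)) * Real.exp (-(deltaH d a / 2 * dist y'' y)) := by
      rw [← Real.exp_add]
      apply Real.exp_le_exp.2
      have := hR y'' hy'' y hy
      have hδ0 : 0 ≤ deltaH d a / 2 := hδ2.le
      nlinarith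
    have hw0 := abs_nonneg (w y)
    calc |w y| * |∑ p ∈ B n y'', v p * kerH n a p y|
        ≤ |w y| * (cH d a * Sn * Real.exp (-(deltaH d a * dist y'' y)) * N y'') :=
          mul_le_mul_of_nonneg_left h hw0
      _ ≤ |w y| * (cH d a * Sn * (Real.exp (-(deltaH d a / 2 * R))
            * Real.exp (-(deltaH d a / 2 * dist y'' y))) * N y'') := by
          gcongr
      _ = Real.exp (-(deltaH d a / 2 * dist y'' y)) * N y'' * |w y|
            * (cH d a * Sn * Real.exp (-(deltaH d a / 2 * R))) := by ring
  -- Schur on the coarse lattice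
  have hschur := schur_finset T'' T (fun y'' y => Real.exp (-(deltaH d a / 2 * dist y'' y)))
    (fun _ _ => (Real.exp_pos _).le) hK
    (fun y'' _ => latticeSum_le d hδ2 T y'')
    (fun y _ => by
      have := latticeSum_le d hδ2 T'' y
      refine le_trans (le_of_eq (Finset.sum_congr rfl fun y'' _ => by rw [dist_comm])) this)
    N (fun y => |w y|)
  have hN2 : ∑ y'' ∈ T'', N y'' ^ 2 = ∑ y'' ∈ T'', ∑ p ∈ B n y'', v p ^ 2 :=
    Finset.sum_congr rfl fun y'' _ => Real.sq_sqrt (Finset.sum_nonneg fun p _ => sq_nonneg _)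
  have hw2 : ∑ y ∈ T, |w y| ^ 2 = ∑ y ∈ T, w y ^ 2 := Finset.sum_congr rfl fun y _ => sq_abs _
  rw [hN2, hw2] at hschur
  calc |∑ y'' ∈ T'', ∑ y ∈ T, w y * ∑ p ∈ B n y'', v p * kerH n a p y|
      ≤ ∑ y'' ∈ T'', |∑ y ∈ T, w y * ∑ p ∈ B n y'', v p * kerH n a p y| := Finset.abs_sum_le_sum_abs _ _
    _ ≤ ∑ y'' ∈ T'', ∑ y ∈ T, |w y * ∑ p ∈ B n y'', v p * kerH n a p y| :=
        Finset.sum_le_sum fun y'' _ => Finset.abs_sum_le_sum_abs _ _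
    _ ≤ ∑ y'' ∈ T'', ∑ y ∈ T, Real.exp (-(deltaH d a / 2 * dist y'' y)) * N y'' * |w y|
          * (cH d a * Sn * Real.exp (-(deltaH d a / 2 * R))) :=
        Finset.sum_le_sum fun y'' hy'' => Finset.sum_le_sum fun y hy => hterm y'' hy'' y hy
    _ = (∑ y'' ∈ T'', ∑ y ∈ T, Real.exp (-(deltaH d a / 2 * dist y'' y)) * N y'' * |w y|)
          * (cH d a * Sn * Real.exp (-(deltaH d a / 2 * R))) := by
        rw [Finset.sum_mul]
        refine Finset.sum_congr rfl fun y'' _ => by rw [Finset.sum_mul]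
    _ ≤ (latticeConst d (deltaH d a / 2) * Real.sqrt (∑ y'' ∈ T'', ∑ p ∈ B n y'', v p ^ 2)
          * Real.sqrt (∑ y ∈ T, w y ^ 2)) * (cH d a * Sn * Real.exp (-(deltaH d a / 2 * R))) :=
        mul_le_mul_of_nonneg_right hschur (by positivity)
    _ = cH d a * latticeConst d (deltaH d a / 2) * Sn * Real.exp (-(deltaH d a / 2 * R))
          * Real.sqrt (∑ y'' ∈ T'', ∑ p ∈ B n y'', v p ^ 2) * Real.sqrt (∑ y ∈ T, w y ^ 2) := by ring

/-! ## §5  `Q'H = I`: the block averages of `H(·,y)` reproduce the data [B5 p.29 «Q_kH_kB = B»] -/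

/-- **`Q'H = I` on `ℤ^d`**: `(n+1)^{−d} Σ_{p ∈ B(y″)} H(p,y) = δ_{y″y}` — the series over `y'` of
`(Q'G'Q'*)(y″,y')·(Q'G'Q'*)⁻¹(y',y)`, which is the two-sided inverse identity of `B4Sect5Exhaustion.tsum_mul_limInv` for the
unit-lattice operator `Q'G'Q'*`. [cite: Balaban1984PropagatorsI, p.29 after (1.63)] -/
theorem blockAvg_kerH (n : ℕ) {a : ℝ} (ha : 0 < a) (y'' y : X d) :
    (((n : ℝ) + 1) ^ d)⁻¹ * ∑ p ∈ B n y'', kerH n a p y = if y'' = y then 1 else 0 := by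
  have h1 : ∑ p ∈ B n y'', kerH n a p y = ∑' y' : X d, (∑ p ∈ B n y'', gq n a p y') * Kinv n a y' y := by
    have := sum_mul_kerH n ha (B n y'') (fun _ => 1) y
    simpa using this
  have h2 : ∀ y' : X d, (((n : ℝ) + 1) ^ d)⁻¹ * ((∑ p ∈ B n y'', gq n a p y') * Kinv n a y' y)
      = KerQGQ n a (toK y'') (toK y') * limInv Set.univ (KerQGQ n a) (toK y') (toK y) := by
    intro y'
    show _ = kerQGQ n a y'' y' * limInv Set.univ (KerQGQ n a) (y', 0) (y, 0)
    rw [kerQGQ, Kinv, ← mul_assoc]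
    rfl
  rw [h1, ← tsum_mul_left]
  simp_rw [h2]
  rw [Equiv.tsum_eq (toK (d := d))
    (fun q => KerQGQ n a (toK y'') q * limInv Set.univ (KerQGQ n a) q (toK y))]
  rw [tsum_mul_limInv (gammaQ_pos d ha) (cU_pos d ha) (deltaU_pos d ha) (hyp56Z_KerQGQ_unif n ha)
    (Set.mem_univ _) (Set.mem_univ _)]
  simp [toK, Prod.ext_iff]

/-! ## §6  The Euler–Lagrange identity `(Δ^η + aQ'*Q')H = Q'*(Q'G'Q'*)⁻¹`, i.e. `Δ^η H = Q'*Φ` with a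
block-constant multiplier [B5 p.29 «H_kB is a minimum of ½⟨∂A, ∂A⟩ on the hyperplane {A : Q_kA = B, R∂*A = 0}»] -/

/-- The finite set carrying the row `A(p,·)` of the site matrix: the block of `p` and its `2d` lattice neighbours. [folklore] -/
def nbhd (n : ℕ) (p : X d) : Finset (X d) :=
  B n (blk n p) ∪ (Finset.univ.image fun μ => p + e μ) ∪ (Finset.univ.image fun μ => p - e μ)

/-- The row `A(p,·)` of `Δ^η + aQ'*Q'` vanishes off `nbhd n p`. [folklore] -/
theorem AX_eq_zero_of_not_mem {n : ℕ} (a : ℝ) {p r : X d} (hr : r ∉ nbhd n p) : AX n a p r = 0 := by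
  simp only [nbhd, Finset.mem_union, Finset.mem_image, Finset.mem_univ, true_and, not_or, not_exists] at hr
  obtain ⟨⟨hB, hplus⟩, hminus⟩ := hr
  have hp : p ∈ B n (blk n p) := mem_B.2 rfl
  have hrp : r ≠ p := fun h => hB (h ▸ hp)
  have hblk : blk n p ≠ blk n r := fun h => hB (mem_B.2 h.symm)
  have h1 : ∀ μ, r ≠ p + e μ := fun μ h => hplus μ h.symm
  have h2 : ∀ μ, r ≠ p - e μ := fun μ h => hminus μ h.symm
  simp [AX, lapKer, lapDir, sameBlk, hrp, h1, h2, hblk]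

/-- The row `(−Δ)(p,·)` of the lattice Laplacian vanishes off `nbhd n p`. [folklore] -/
theorem lapKer_eq_zero_of_not_mem {n : ℕ} {p r : X d} (hr : r ∉ nbhd n p) : lapKer p r = 0 := by
  have h0 := AX_eq_zero_of_not_mem (n := n) (0 : ℝ) hr
  simp only [AX, zero_div, zero_mul, add_zero] at h0
  have hn : ((n : ℝ) + 1) ^ 2 ≠ 0 := by positivity
  exact (mul_eq_zero.1 h0).resolve_left hn

/-- Row sums against the site matrix are finite sums over `nbhd n p`. [folklore] -/
theorem tsum_AX_mul (n : ℕ) (a : ℝ) (p : X d) (f : X d → ℝ) :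
    ∑' r : X d, AX n a p r * f r = ∑ r ∈ nbhd n p, AX n a p r * f r :=
  tsum_eq_sum (s := nbhd n p) (fun r hr => by rw [AX_eq_zero_of_not_mem a hr, zero_mul])

/-- `A G' = I` on `ℤ^d`, entrywise: `Σ_r A(p,r) G'(r,q) = δ_{pq}` (`B4Sect5Exhaustion.tsum_mul_limInv` for the site matrix,
`B6QGQLower276.hyp56Z_Aker`). [cite: Balaban1983RegularityDecay, Sect. 5 Theorem p.594] -/
theorem sum_AX_mul_Gk (n : ℕ) {a : ℝ} (ha : 0 < a) (p q : X d) :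
    ∑ r ∈ nbhd n p, AX n a p r * Gk n a r q = if p = q then 1 else 0 := by
  rw [← tsum_AX_mul n a p (fun r => Gk n a r q)]
  have h2 : ∀ r : X d, AX n a p r * Gk n a r q
      = Aker n a (toK p) (toK r) * limInv Set.univ (Aker n a) (toK r) (toK q) := fun r => rfl
  simp_rw [h2]
  rw [Equiv.tsum_eq (toK (d := d)) (fun r' => Aker n a (toK p) r' * limInv Set.univ (Aker n a) r' (toK q))]
  rw [tsum_mul_limInv (lt_min two_pos ha) (c0_pos d n ha.ne') one_pos (hyp56Z_Aker n a)
    (Set.mem_univ _) (Set.mem_univ _)]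
  simp [toK, Prod.ext_iff]

/-- `A (G'Q'*) = Q'*` entrywise: `Σ_r A(p,r)(G'Q'*)(r,y') = 1[blk p = y']`. [folklore] -/
theorem sum_AX_mul_gq (n : ℕ) {a : ℝ} (ha : 0 < a) (p y' : X d) :
    ∑ r ∈ nbhd n p, AX n a p r * gq n a r y' = if blk n p = y' then 1 else 0 := by
  classical
  calc ∑ r ∈ nbhd n p, AX n a p r * gq n a r y'
      = ∑ r ∈ nbhd n p, ∑ q ∈ B n y', AX n a p r * Gk n a r q := by
        refine Finset.sum_congr rfl fun r _ => ?_
        rw [gq, Finset.mul_sum]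
    _ = ∑ q ∈ B n y', ∑ r ∈ nbhd n p, AX n a p r * Gk n a r q := Finset.sum_comm
    _ = ∑ q ∈ B n y', (if p = q then (1 : ℝ) else 0) :=
        Finset.sum_congr rfl fun q _ => sum_AX_mul_Gk n ha p q
    _ = if p ∈ B n y' then (1 : ℝ) else 0 := Finset.sum_ite_eq _ _ _
    _ = if blk n p = y' then 1 else 0 := by simp only [mem_B]

/-- **THE EULER–LAGRANGE IDENTITY `(Δ^η + aQ'*Q')H = Q'*(Q'G'Q'*)⁻¹`** on `ℤ^d`, entrywise:
`Σ_r A(p,r) H(r,y) = (Q'G'Q'*)⁻¹(blk p, y)` — the right-hand side is block-constant in `p`. [cite: Balaban1984PropagatorsI, (1.103) p.34] -/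
theorem tsum_AX_mul_kerH (n : ℕ) {a : ℝ} (ha : 0 < a) (p y : X d) :
    ∑' r : X d, AX n a p r * kerH n a r y = Kinv n a (blk n p) y := by
  classical
  rw [tsum_AX_mul n a p, sum_mul_kerH n ha (nbhd n p) (fun r => AX n a p r) y]
  rw [tsum_eq_single (blk n p) (fun y' hy' => by
    rw [sum_AX_mul_gq n ha p y', if_neg (Ne.symm hy'), zero_mul])]
  rw [sum_AX_mul_gq n ha p (blk n p), if_pos rfl, one_mul]

/-- **`Δ^η H = Q'*Φ` with the block-constant multiplier `Φ = (Q'G'Q'*)⁻¹ − a·I`**: for every fine site `p` and block `y`,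
`Σ_r (n+1)²(−Δ)(p,r) H(r,y) = (Q'G'Q'*)⁻¹(blk p, y) − a·δ_{blk p, y}` — `H(·,y)` is discrete-harmonic up to a
block-constant function, the Euler–Lagrange equation of the constrained minimisation «H_kB is a minimum of ½⟨∂A, ∂A⟩
on the hyperplane {A : Q_kA = B, R∂*A = 0}» in the scalar analogue. [cite: Balaban1984PropagatorsI, p.29 after (1.63)] -/
theorem tsum_lap_mul_kerH (n : ℕ) {a : ℝ} (ha : 0 < a) (p y : X d) :
    ∑' r : X d, (((n : ℝ) + 1) ^ 2 * lapKer p r) * kerH n a r y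
      = Kinv n a (blk n p) y - a * (if blk n p = y then 1 else 0) := by
  classical
  have hEL := tsum_AX_mul_kerH n ha p y
  -- split the site matrix into its Laplacian and block parts (both finitely supported rows)
  have hsuppL : ∀ r ∉ nbhd n p, (((n : ℝ) + 1) ^ 2 * lapKer p r) * kerH n a r y = 0 := by
    intro r hr
    rw [lapKer_eq_zero_of_not_mem hr, mul_zero, zero_mul]
  have hsuppB : ∀ r ∉ B n (blk n p), (a / ((n : ℝ) + 1) ^ d * sameBlk n p r) * kerH n a r y = 0 := by
    intro r hr
    have : sameBlk n p r = 0 := by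
      rw [sameBlk, if_neg]
      exact fun h => hr (mem_B.2 h.symm)
    rw [this, mul_zero, zero_mul]
  have hsL : Summable fun r : X d => (((n : ℝ) + 1) ^ 2 * lapKer p r) * kerH n a r y :=
    summable_of_ne_finset_zero hsuppL
  have hsB : Summable fun r : X d => (a / ((n : ℝ) + 1) ^ d * sameBlk n p r) * kerH n a r y :=
    summable_of_ne_finset_zero hsuppB
  have hsplit : ∑' r : X d, AX n a p r * kerH n a r y
      = ∑' r : X d, (((n : ℝ) + 1) ^ 2 * lapKer p r) * kerH n a r y
        + ∑' r : X d, (a / ((n : ℝ) + 1) ^ d * sameBlk n p r) * kerH n a r y := by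
    rw [← hsL.tsum_add hsB]
    refine tsum_congr fun r => ?_
    rw [AX]; ring
  -- the block part is `a` times the block average, i.e. `a·δ_{blk p, y}` by `Q'H = I`
  have hblock : ∑' r : X d, (a / ((n : ℝ) + 1) ^ d * sameBlk n p r) * kerH n a r y
      = a * (if blk n p = y then 1 else 0) := by
    rw [tsum_eq_sum (s := B n (blk n p)) hsuppB, ← blockAvg_kerH n ha (blk n p) y, Finset.mul_sum, Finset.mul_sum]
    refine Finset.sum_congr rfl fun r hr => ?_
    have : sameBlk n p r = 1 := by
      rw [sameBlk, if_pos (mem_B.1 hr).symm]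
    rw [this]; ring
  rw [hsplit, hblock] at hEL
  linarith

/-- A block-constant field is orthogonal to every finitely supported `A'` with `Q'A' = 0`. [folklore] -/
theorem sum_mul_blockConst_eq_zero {n : ℕ} (S : Finset (X d)) (A' : X d → ℝ) (hS : ∀ r ∉ S, A' r = 0)
    (hQ : ∀ y'' : X d, ∑ r ∈ B n y'', A' r = 0) (φ : X d → ℝ) :
    ∑ p ∈ S, A' p * φ (blk n p) = 0 := by
  classical
  set T'' : Finset (X d) := S.image (blk n) with hT''
  have hsub : S ⊆ T''.biUnion (B n) := by
    intro r hr
    rw [Finset.mem_biUnion]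
    exact ⟨blk n r, Finset.mem_image_of_mem _ hr, mem_B.2 rfl⟩
  have hpd : Set.PairwiseDisjoint (↑T'' : Set (X d)) (B n) := fun y₁ _ y₂ _ hne => B_disjoint hne
  rw [Finset.sum_subset hsub (fun r _ hr => by rw [hS r hr, zero_mul]), Finset.sum_biUnion hpd]
  refine Finset.sum_eq_zero fun y'' _ => ?_
  calc ∑ r ∈ B n y'', A' r * φ (blk n r) = ∑ r ∈ B n y'', A' r * φ y'' :=
        Finset.sum_congr rfl fun r hr => by rw [mem_B.1 hr]
    _ = (∑ r ∈ B n y'', A' r) * φ y'' := by rw [Finset.sum_mul]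
    _ = 0 := by rw [hQ y'', zero_mul]

/-! ## §7  The weak Euler–Lagrange equation «⟨∂A′, ∂H_kB⟩ = 0 on the subspace {A′ : Q_kA′ = 0, R∂*A′ = 0}» (scalar analogue) -/

/-- **WEAK EULER–LAGRANGE EQUATION** [B5 p.29]: for every finitely supported fine field `A'` with vanishing block
averages (`Q'A' = 0`) and every block `y`, `⟨Δ^ηA', H(·,y)⟩ = Σ'_p (Σ_r (n+1)²(−Δ)(p,r)A'(r)) H(p,y) = 0` — i.e.
`⟨∂A', ∂(Hδ_y)⟩ = 0` after summation by parts; by linearity the same holds for `HB`, `B` finitely supported.  This is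
the scalar analogue of «⟨∂A′, ∂H_kB⟩ = 0 on the subspace {A′ : Q_kA′ = 0, R∂*A′ = 0}» (no gauge condition in the scalar
case).  Proof: `Δ^η` is symmetric with finite rows, `Δ^ηH(·,y) = Q'*Φ(·,y)` is block-constant (`tsum_lap_mul_kerH`), and
a block-constant field is orthogonal to every `A'` with `Q'A' = 0`. [cite: Balaban1984PropagatorsI, p.29 after (1.63)] -/
theorem weakEL_kerH (n : ℕ) {a : ℝ} (ha : 0 < a) (S : Finset (X d)) (A' : X d → ℝ) (hS : ∀ r ∉ S, A' r = 0)
    (hQ : ∀ y'' : X d, ∑ r ∈ B n y'', A' r = 0) (y : X d) :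
    ∑' p : X d, (∑ r ∈ S, ((n : ℝ) + 1) ^ 2 * lapKer p r * A' r) * kerH n a p y = 0 := by
  classical
  set φ : X d → ℝ := fun y'' => Kinv n a y'' y - a * (if y'' = y then 1 else 0) with hφ
  -- (1) symmetry of the Laplacian and exchange of the finite sum with the series
  have hsumm : ∀ r ∈ S, Summable fun p : X d => A' r * ((((n : ℝ) + 1) ^ 2 * lapKer r p) * kerH n a p y) := by
    intro r _
    refine (summable_of_ne_finset_zero (s := nbhd n r) fun p hp => ?_).mul_left (A' r)
    rw [lapKer_eq_zero_of_not_mem hp, mul_zero, zero_mul]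
  have h1 : ∑' p : X d, (∑ r ∈ S, ((n : ℝ) + 1) ^ 2 * lapKer p r * A' r) * kerH n a p y
      = ∑ r ∈ S, A' r * φ (blk n r) := by
    calc ∑' p : X d, (∑ r ∈ S, ((n : ℝ) + 1) ^ 2 * lapKer p r * A' r) * kerH n a p y
        = ∑' p : X d, ∑ r ∈ S, A' r * ((((n : ℝ) + 1) ^ 2 * lapKer r p) * kerH n a p y) := by
          refine tsum_congr fun p => ?_
          rw [Finset.sum_mul]
          refine Finset.sum_congr rfl fun r _ => ?_
          rw [lapKer_symm p r]; ring
      _ = ∑ r ∈ S, ∑' p : X d, A' r * ((((n : ℝ) + 1) ^ 2 * lapKer r p) * kerH n a p y) :=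
          Summable.tsum_finsetSum hsumm
      _ = ∑ r ∈ S, A' r * φ (blk n r) := by
          refine Finset.sum_congr rfl fun r _ => ?_
          rw [tsum_mul_left, tsum_lap_mul_kerH n ha r y]
  -- (2) a block-constant field is orthogonal to `A'` when all block sums of `A'` vanish
  rw [h1]
  exact sum_mul_blockConst_eq_zero S A' hS hQ φ

/-! ## §8  Local minimality: «H_kB is a minimum of ½⟨∂A, ∂A⟩ on the hyperplane {A : Q_kA = B, R∂*A = 0}» (scalar analogue,
finite-energy perturbations) -/

/-- The bond window of a finite set `S`: `S` together with its backward translates `S − e_μ`; every lattice bond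
`(r, r+e_μ)` meeting `S` has `r ∈ win S`. [folklore] -/
def win (S : Finset (X d)) : Finset (X d) := S ∪ Finset.univ.biUnion fun μ => S.image fun p => p - e μ

/-- `S ⊆ win S`. [folklore] -/
theorem subset_win (S : Finset (X d)) : S ⊆ win S := Finset.subset_union_left

/-- `S − e_μ ⊆ win S`. [folklore] -/
theorem sub_e_mem_win {S : Finset (X d)} {p : X d} (hp : p ∈ S) (μ : Fin d) : p - e μ ∈ win S := by
  refine Finset.mem_union_right _ (Finset.mem_biUnion.2 ⟨μ, Finset.mem_univ _, ?_⟩)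
  exact Finset.mem_image.2 ⟨p, hp, rfl⟩

/-- Off the window both ends of a bond lie outside the support: `A'(r) = A'(r+e_μ) = 0` for `r ∉ win S`. [folklore] -/
theorem eq_zero_off_win {S : Finset (X d)} {A' : X d → ℝ} (hS : ∀ r ∉ S, A' r = 0) {r : X d} (hr : r ∉ win S)
    (μ : Fin d) : A' r = 0 ∧ A' (r + e μ) = 0 := by
  refine ⟨hS r fun h => hr (subset_win S h), hS (r + e μ) fun h => hr ?_⟩
  have := sub_e_mem_win h μ
  rwa [add_sub_cancel_right] at this

/-- The explicit three-point form of the Laplacian row sum: `Σ'_r (−Δ)(p,r)h(r) = Σ_μ (2h(p) − h(p+e_μ) − h(p−e_μ))`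
for EVERY `h : ℤ^d → ℝ` (finite row). [folklore] -/
theorem tsum_lapKer_mul (p : X d) (h : X d → ℝ) :
    ∑' r : X d, lapKer p r * h r = ∑ μ, (2 * h p - h (p + e μ) - h (p - e μ)) := by
  classical
  rw [tsum_eq_sum (s := nbhd 0 p) (fun r hr => by rw [lapKer_eq_zero_of_not_mem (n := 0) hr, zero_mul])]
  have hp : p ∈ nbhd 0 p := Finset.mem_union_left _ (Finset.mem_union_left _ (mem_B.2 rfl))
  have hplus : ∀ μ, p + e μ ∈ nbhd 0 p := fun μ =>
    Finset.mem_union_left _ (Finset.mem_union_right _ (Finset.mem_image.2 ⟨μ, Finset.mem_univ _, rfl⟩))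
  have hminus : ∀ μ, p - e μ ∈ nbhd 0 p := fun μ =>
    Finset.mem_union_right _ (Finset.mem_image.2 ⟨μ, Finset.mem_univ _, rfl⟩)
  calc ∑ r ∈ nbhd 0 p, lapKer p r * h r = ∑ r ∈ nbhd 0 p, ∑ μ, lapDir μ p r * h r := by
        refine Finset.sum_congr rfl fun r _ => ?_
        rw [lapKer, Finset.sum_mul]
    _ = ∑ μ, ∑ r ∈ nbhd 0 p, lapDir μ p r * h r := Finset.sum_comm
    _ = ∑ μ, (2 * h p - h (p + e μ) - h (p - e μ)) := by
        refine Finset.sum_congr rfl fun μ _ => ?_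
        simp only [lapDir, sub_mul, ite_mul, zero_mul, one_mul, Finset.sum_sub_distrib, Finset.sum_ite_eq', hp,
          hplus μ, hminus μ, if_true]

/-- **Summation by parts against a finitely supported field** (one direction): for `A'` vanishing off `S` and ANY `h`,
`Σ_{r∈win S} (A'(r) − A'(r+e_μ))(h(r) − h(r+e_μ)) = Σ_{p∈S} A'(p)(2h(p) − h(p+e_μ) − h(p−e_μ))`. [folklore] -/
theorem sbp_window (S : Finset (X d)) (A' h : X d → ℝ) (hS : ∀ r ∉ S, A' r = 0) (μ : Fin d) :
    ∑ r ∈ win S, (A' r - A' (r + e μ)) * (h r - h (r + e μ))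
      = ∑ p ∈ S, A' p * (2 * h p - h (p + e μ) - h (p - e μ)) := by
  classical
  have hSW := subset_win S
  -- the `A'(r)` terms live on `S`
  have h1 : ∑ r ∈ win S, A' r * (h r - h (r + e μ)) = ∑ p ∈ S, A' p * (h p - h (p + e μ)) :=
    (Finset.sum_subset hSW (fun r _ hr => by rw [hS r hr, zero_mul])).symm
  -- the `A'(r+e_μ)` terms, re-indexed by `s = r + e_μ`, live on `S` too
  have hinj : Set.InjOn (fun r : X d => r + e μ) ↑(win S) := fun r _ r' _ h => add_right_cancel h
  have h2 : ∑ r ∈ win S, A' (r + e μ) * (h r - h (r + e μ)) = ∑ p ∈ S, A' p * (h (p - e μ) - h p) := by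
    have himg : ∑ s ∈ (win S).image (fun r => r + e μ), A' s * (h (s - e μ) - h s)
        = ∑ r ∈ win S, A' (r + e μ) * (h r - h (r + e μ)) := by
      rw [Finset.sum_image hinj]
      refine Finset.sum_congr rfl fun r _ => by rw [add_sub_cancel_right]
    have hSI : S ⊆ (win S).image (fun r => r + e μ) := by
      intro s hs
      exact Finset.mem_image.2 ⟨s - e μ, sub_e_mem_win hs μ, sub_add_cancel s (e μ)⟩
    rw [← himg]
    exact (Finset.sum_subset hSI (fun s _ hs => by rw [hS s hs, zero_mul])).symm
  have hsplit : ∑ r ∈ win S, (A' r - A' (r + e μ)) * (h r - h (r + e μ))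
      = ∑ r ∈ win S, A' r * (h r - h (r + e μ)) - ∑ r ∈ win S, A' (r + e μ) * (h r - h (r + e μ)) := by
    rw [← Finset.sum_sub_distrib]
    exact Finset.sum_congr rfl fun r _ => by ring
  rw [hsplit, h1, h2, ← Finset.sum_sub_distrib]
  exact Finset.sum_congr rfl fun p _ => by ring

/-- **`∂H(·,y) ⊥ ∂A'`**: for every finitely supported `A'` with `Q'A' = 0`, the bond pairing over the window vanishes,
`Σ_μ Σ_{r∈win S} (A'(r) − A'(r+e_μ))(H(r,y) − H(r+e_μ,y)) = 0` (all bonds outside `win S` have `∂A' = 0`).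
[cite: Balaban1984PropagatorsI, p.29 after (1.63)] -/
theorem bondPairing_kerH_eq_zero (n : ℕ) {a : ℝ} (ha : 0 < a) (S : Finset (X d)) (A' : X d → ℝ)
    (hS : ∀ r ∉ S, A' r = 0) (hQ : ∀ y'' : X d, ∑ r ∈ B n y'', A' r = 0) (y : X d) :
    ∑ μ, ∑ r ∈ win S, (A' r - A' (r + e μ)) * (kerH n a r y - kerH n a (r + e μ) y) = 0 := by
  have hn : ((n : ℝ) + 1) ^ 2 ≠ 0 := by positivity
  calc ∑ μ, ∑ r ∈ win S, (A' r - A' (r + e μ)) * (kerH n a r y - kerH n a (r + e μ) y)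
      = ∑ μ, ∑ p ∈ S, A' p * (2 * kerH n a p y - kerH n a (p + e μ) y - kerH n a (p - e μ) y) :=
        Finset.sum_congr rfl fun μ _ => sbp_window S A' (fun r => kerH n a r y) hS μ
    _ = ∑ p ∈ S, A' p * ∑ μ, (2 * kerH n a p y - kerH n a (p + e μ) y - kerH n a (p - e μ) y) := by
        rw [Finset.sum_comm]
        exact Finset.sum_congr rfl fun p _ => by rw [Finset.mul_sum]
    _ = ∑ p ∈ S, A' p * ((((n : ℝ) + 1) ^ 2)⁻¹
          * (Kinv n a (blk n p) y - a * (if blk n p = y then 1 else 0))) := by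
        refine Finset.sum_congr rfl fun p _ => ?_
        congr 1
        rw [← tsum_lapKer_mul p (fun r => kerH n a r y), ← tsum_lap_mul_kerH n ha p y, ← tsum_mul_left]
        refine tsum_congr fun r => ?_
        field_simp
    _ = 0 := sum_mul_blockConst_eq_zero S A' hS hQ
          (fun y'' => (((n : ℝ) + 1) ^ 2)⁻¹ * (Kinv n a y'' y - a * (if y'' = y then 1 else 0)))

/-- **LOCAL MINIMALITY OF THE DIRICHLET ENERGY** [B5 p.29 «H_kB is a minimum of ½⟨∂A, ∂A⟩ on the hyperplane {A : Q_kA = B, R∂*A = 0}»,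
scalar analogue on `ℤ^d`]: for every finitely supported `A'` with `Q'A' = 0` — i.e. every competitor `H(·,y) + A'`
with the same block averages that differs from `H(·,y)` at finitely many sites — the Dirichlet energy over the bond
window (which carries the whole difference, `eq_zero_off_win`) satisfies
`Σ_μΣ_{r∈win S} |∂(H+A')|² = Σ_μΣ_{r∈win S} |∂H|² + Σ_μΣ_{r∈win S} |∂A'|²`; in particular it is `≥` the energy of `H(·,y)`,
with equality iff `∂A' = 0`. (Infinite-volume reading: finite-energy perturbations; the global energy of `H(·,y)`
itself is finite by the decay of §4 but is not needed.) [cite: Balaban1984PropagatorsI, p.29 after (1.63)] -/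
theorem energy_kerH_add (n : ℕ) {a : ℝ} (ha : 0 < a) (S : Finset (X d)) (A' : X d → ℝ)
    (hS : ∀ r ∉ S, A' r = 0) (hQ : ∀ y'' : X d, ∑ r ∈ B n y'', A' r = 0) (y : X d) :
    ∑ μ, ∑ r ∈ win S, ((kerH n a r y + A' r) - (kerH n a (r + e μ) y + A' (r + e μ))) ^ 2
      = ∑ μ, ∑ r ∈ win S, (kerH n a r y - kerH n a (r + e μ) y) ^ 2
        + ∑ μ, ∑ r ∈ win S, (A' r - A' (r + e μ)) ^ 2 := by
  have h0 := bondPairing_kerH_eq_zero n ha S A' hS hQ y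
  have hexp : ∑ μ, ∑ r ∈ win S, ((kerH n a r y + A' r) - (kerH n a (r + e μ) y + A' (r + e μ))) ^ 2
      = ∑ μ, ∑ r ∈ win S, (kerH n a r y - kerH n a (r + e μ) y) ^ 2
        + 2 * ∑ μ, ∑ r ∈ win S, (A' r - A' (r + e μ)) * (kerH n a r y - kerH n a (r + e μ) y)
        + ∑ μ, ∑ r ∈ win S, (A' r - A' (r + e μ)) ^ 2 := by
    rw [Finset.mul_sum, ← Finset.sum_add_distrib, ← Finset.sum_add_distrib]
    refine Finset.sum_congr rfl fun μ _ => ?_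
    rw [Finset.mul_sum, ← Finset.sum_add_distrib, ← Finset.sum_add_distrib]
    exact Finset.sum_congr rfl fun r _ => by ring
  rw [hexp, h0, mul_zero, add_zero]

/-- Corollary: the window energy of any admissible competitor is at least that of `H(·,y)`. [folklore] -/
theorem energy_kerH_le (n : ℕ) {a : ℝ} (ha : 0 < a) (S : Finset (X d)) (A' : X d → ℝ)
    (hS : ∀ r ∉ S, A' r = 0) (hQ : ∀ y'' : X d, ∑ r ∈ B n y'', A' r = 0) (y : X d) :
    ∑ μ, ∑ r ∈ win S, (kerH n a r y - kerH n a (r + e μ) y) ^ 2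
      ≤ ∑ μ, ∑ r ∈ win S, ((kerH n a r y + A' r) - (kerH n a (r + e μ) y + A' (r + e μ))) ^ 2 := by
  rw [energy_kerH_add n ha S A' hS hQ y]
  have : 0 ≤ ∑ μ, ∑ r ∈ win S, (A' r - A' (r + e μ)) ^ 2 :=
    Finset.sum_nonneg fun μ _ => Finset.sum_nonneg fun r _ => sq_nonneg _
  linarith

/-! ## §9  Reproduction of constants: `H·1 = 1` (row sums of the kernel), via `G'·1 = a⁻¹`, `(Q'G'Q'*)·1 = a⁻¹`,
`(Q'G'Q'*)⁻¹·1 = a` — Fubini for lattice kernels with exponential majorants -/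

/-- **Fubini majorant**: a two-variable lattice kernel dominated by `C e^{−α|x−q|} e^{−β|q−r|}` is summable on
`ℤ^d × ℤ^d`. [folklore] -/
theorem summable_uncurry_of_majorant {F : X d → X d → ℝ} {C α β : ℝ} (hα : 0 < α) (hβ : 0 < β) (x : X d)
    (hF : ∀ q r, |F q r| ≤ C * Real.exp (-(α * dist x q)) * Real.exp (-(β * dist q r))) :
    Summable (Function.uncurry F) := by
  set g : X d × X d → ℝ := fun qr => |C| * Real.exp (-(α * dist x qr.1)) * Real.exp (-(β * dist qr.1 qr.2))
    with hg
  have hg0 : 0 ≤ g := fun qr => by simp only [hg]; positivity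
  have hgs : Summable g := by
    refine (summable_prod_of_nonneg hg0).2 ⟨fun q => ?_, ?_⟩
    · simpa only [hg] using (summable_expX hβ q).mul_left (|C| * Real.exp (-(α * dist x q)))
    · have hrow : ∀ q : X d, ∑' r : X d, g (q, r)
          = |C| * Real.exp (-(α * dist x q)) * ∑' r : X d, Real.exp (-(β * dist q r)) := by
        intro q; simp only [hg]; rw [tsum_mul_left]
      simp_rw [hrow]
      refine Summable.of_nonneg_of_le (fun q => ?_) (fun q => ?_)
        ((summable_expX hα x).mul_left (|C| * latticeConst d β))
      · have : 0 ≤ ∑' r : X d, Real.exp (-(β * dist q r)) := tsum_nonneg fun r => (Real.exp_pos _).le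
        positivity
      · have hK := tsum_expX_le hβ q
        have h0 : 0 ≤ |C| * Real.exp (-(α * dist x q)) := by positivity
        calc |C| * Real.exp (-(α * dist x q)) * ∑' r : X d, Real.exp (-(β * dist q r))
            ≤ |C| * Real.exp (-(α * dist x q)) * latticeConst d β := mul_le_mul_of_nonneg_left hK h0
          _ = |C| * latticeConst d β * Real.exp (-(α * dist x q)) := by ring
  refine Summable.of_norm_bounded hgs fun qr => ?_
  rw [Real.norm_eq_abs]
  refine (hF qr.1 qr.2).trans ?_
  simp only [hg]
  have h1 : 0 ≤ Real.exp (-(α * dist x qr.1)) * Real.exp (-(β * dist qr.1 qr.2)) := by positivity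
  calc C * Real.exp (-(α * dist x qr.1)) * Real.exp (-(β * dist qr.1 qr.2))
      = C * (Real.exp (-(α * dist x qr.1)) * Real.exp (-(β * dist qr.1 qr.2))) := by ring
    _ ≤ |C| * (Real.exp (-(α * dist x qr.1)) * Real.exp (-(β * dist qr.1 qr.2))) :=
        mul_le_mul_of_nonneg_right (le_abs_self C) h1
    _ = |C| * Real.exp (-(α * dist x qr.1)) * Real.exp (-(β * dist qr.1 qr.2)) := by ring

/-- **Fubini for lattice kernels** (exchange of the order of summation under an exponential majorant):
`Σ'_q f(q)·(Σ'_r g(q,r)) = Σ'_r Σ'_q f(q)g(q,r)`. [folklore] -/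
theorem tsum_mul_tsum_comm {f : X d → ℝ} {g : X d → X d → ℝ} {C α β : ℝ} (hα : 0 < α) (hβ : 0 < β) (x : X d)
    (h : ∀ q r, |f q * g q r| ≤ C * Real.exp (-(α * dist x q)) * Real.exp (-(β * dist q r))) :
    ∑' q : X d, f q * ∑' r : X d, g q r = ∑' r : X d, ∑' q : X d, f q * g q r := by
  have hs : Summable (Function.uncurry fun q r => f q * g q r) := summable_uncurry_of_majorant hα hβ x h
  have h₁ : ∀ q : X d, Summable fun r : X d => f q * g q r := fun q => hs.prod_factor q
  have h₂ : ∀ r : X d, Summable fun q : X d => f q * g q r := fun r => hs.prod_symm.prod_factor r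
  calc ∑' q : X d, f q * ∑' r : X d, g q r = ∑' q : X d, ∑' r : X d, f q * g q r :=
        tsum_congr fun q => (tsum_mul_left).symm
    _ = ∑' r : X d, ∑' q : X d, f q * g q r := (hs.tsum_comm' h₁ h₂).symm

/-- The blocks partition the lattice: `ℤ^d × {0,…,n}^d ≃ ℤ^d`, `(y, z) ↦ chart n y z`. [folklore] -/
def blockEquiv (n : ℕ) : X d × (Fin d → Fin (n + 1)) ≃ X d where
  toFun yz := chart n yz.1 yz.2
  invFun q := (blk n q, locFin n q)
  left_inv yz := Prod.ext (blk_chart n yz.1 yz.2) (locFin_chart n yz.1 yz.2)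
  right_inv q := chart_blk_locFin n q

/-- Block sums of a summable function are summable over the blocks. [folklore] -/
theorem summable_blocks (n : ℕ) {f : X d → ℝ} (hf : Summable f) :
    Summable fun y : X d => ∑ q ∈ B n y, f q := by
  have hF : Summable fun yz : X d × (Fin d → Fin (n + 1)) => f (chart n yz.1 yz.2) :=
    (blockEquiv (d := d) n).summable_iff.2 hf
  refine hF.prod.congr fun y => ?_
  show ∑' z : Fin d → Fin (n + 1), f (chart n y z) = ∑ q ∈ B n y, f q
  rw [tsum_fintype, sum_B]

/-- **Summation block by block**: `Σ'_y Σ_{q∈B(y)} f(q) = Σ'_q f(q)` for summable `f`. [folklore] -/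
theorem tsum_blocks (n : ℕ) {f : X d → ℝ} (hf : Summable f) :
    ∑' y : X d, ∑ q ∈ B n y, f q = ∑' q : X d, f q := by
  have hF : Summable fun yz : X d × (Fin d → Fin (n + 1)) => f (chart n yz.1 yz.2) :=
    (blockEquiv (d := d) n).summable_iff.2 hf
  calc ∑' y : X d, ∑ q ∈ B n y, f q = ∑' y : X d, ∑' z : Fin d → Fin (n + 1), f (chart n y z) :=
        tsum_congr fun y => by rw [tsum_fintype, sum_B]
    _ = ∑' yz : X d × (Fin d → Fin (n + 1)), f (chart n yz.1 yz.2) :=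
        (hF.tsum_prod' fun y => hF.prod_factor y).symm
    _ = ∑' q : X d, f q := (blockEquiv (d := d) n).tsum_eq f

/-- **`A·1 = a`**: the row sums of the site matrix `Δ^η + aQ'*Q'` are `a` (the Laplacian kills constants, each block
has `(n+1)^d` sites). [folklore] -/
theorem tsum_AX_row (n : ℕ) (a : ℝ) (q : X d) : ∑' r : X d, AX n a q r = a := by
  classical
  have hn : (0 : ℝ) < ((n : ℝ) + 1) ^ d := by positivity
  have hsuppL : ∀ r ∉ nbhd n q, ((n : ℝ) + 1) ^ 2 * lapKer q r = 0 := fun r hr => by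
    rw [lapKer_eq_zero_of_not_mem hr, mul_zero]
  have hsuppB : ∀ r ∉ B n (blk n q), a / ((n : ℝ) + 1) ^ d * sameBlk n q r = 0 := by
    intro r hr
    have : sameBlk n q r = 0 := by
      rw [sameBlk, if_neg]
      exact fun h => hr (mem_B.2 h.symm)
    rw [this, mul_zero]
  have hsL : Summable fun r : X d => ((n : ℝ) + 1) ^ 2 * lapKer q r := summable_of_ne_finset_zero hsuppL
  have hsB : Summable fun r : X d => a / ((n : ℝ) + 1) ^ d * sameBlk n q r := summable_of_ne_finset_zero hsuppB
  have hlap : ∑' r : X d, ((n : ℝ) + 1) ^ 2 * lapKer q r = 0 := by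
    rw [tsum_mul_left]
    have h1 := tsum_lapKer_mul q (fun _ => (1 : ℝ))
    simp only [mul_one] at h1
    rw [h1]; norm_num
  have hblk : ∑' r : X d, a / ((n : ℝ) + 1) ^ d * sameBlk n q r = a := by
    rw [tsum_eq_sum (s := B n (blk n q)) hsuppB]
    have : ∀ r ∈ B n (blk n q), a / ((n : ℝ) + 1) ^ d * sameBlk n q r = a / ((n : ℝ) + 1) ^ d := by
      intro r hr
      rw [sameBlk, if_pos (mem_B.1 hr).symm, mul_one]
    rw [Finset.sum_congr rfl this, sum_B_const]
    field_simp
  calc ∑' r : X d, AX n a q r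
      = ∑' r : X d, (((n : ℝ) + 1) ^ 2 * lapKer q r + a / ((n : ℝ) + 1) ^ d * sameBlk n q r) := rfl
    _ = ∑' r : X d, ((n : ℝ) + 1) ^ 2 * lapKer q r + ∑' r : X d, a / ((n : ℝ) + 1) ^ d * sameBlk n q r :=
        hsL.tsum_add hsB
    _ = a := by rw [hlap, hblk, zero_add]

/-- `G'A = I` on `ℤ^d`, entrywise with the series over the middle index: `Σ'_q G'(p,q)A(q,r) = δ_{pr}`. [folklore] -/
theorem tsum_Gk_mul_AX (n : ℕ) {a : ℝ} (ha : 0 < a) (p r : X d) :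
    ∑' q : X d, Gk n a p q * AX n a q r = if p = r then 1 else 0 := by
  have h2 : ∀ q : X d, Gk n a p q * AX n a q r
      = limInv Set.univ (Aker n a) (toK p) (toK q) * Aker n a (toK q) (toK r) := fun q => rfl
  simp_rw [h2]
  rw [Equiv.tsum_eq (toK (d := d)) (fun q' => limInv Set.univ (Aker n a) (toK p) q' * Aker n a q' (toK r))]
  rw [tsum_limInv_mul (lt_min two_pos ha) (c0_pos d n ha.ne') one_pos (hyp56Z_Aker n a)
    (Set.mem_univ _) (Set.mem_univ _)]
  simp [toK, Prod.ext_iff]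

/-- The rows of `G'` are summable. [folklore] -/
theorem summable_Gk_row (n : ℕ) {a : ℝ} (ha : 0 < a) (p : X d) : Summable fun q : X d => Gk n a p q := by
  have hα : 0 < deltaU d a / ((n : ℝ) + 1) := div_pos (deltaU_pos d ha) (by positivity)
  refine Summable.of_norm_bounded ((summable_expX hα p).mul_left (2 / min 2 a)) fun q => ?_
  rw [Real.norm_eq_abs]
  refine (abs_Gk_le n ha p q).trans (le_of_eq ?_)
  congr 2; ring

/-- **`G'·1 = a⁻¹`**: the row sums of `G' = (Δ^η + aQ'*Q')⁻¹` on `ℤ^d` equal `1/a`. [folklore] -/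
theorem tsum_Gk_row (n : ℕ) {a : ℝ} (ha : 0 < a) (p : X d) : ∑' q : X d, Gk n a p q = 1 / a := by
  have hα : 0 < deltaU d a / ((n : ℝ) + 1) := div_pos (deltaU_pos d ha) (by positivity)
  -- `a · Σ_q G'(p,q) = Σ_q G'(p,q) Σ_r A(q,r) = Σ_r Σ_q G'(p,q)A(q,r) = Σ_r δ_{pr} = 1`
  have hswap := tsum_mul_tsum_comm (f := fun q => Gk n a p q) (g := fun q r => AX n a q r)
    (C := 2 / min 2 a * c0 d n a) hα one_pos p (fun q r => by
      rw [abs_mul]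
      have h1 := abs_Gk_le n ha p q
      have h2 := abs_AX_le n a q r
      have e1 : Real.exp (-(deltaU d a * (dist p q / ((n : ℝ) + 1))))
          = Real.exp (-(deltaU d a / ((n : ℝ) + 1) * dist p q)) := by congr 1; ring
      rw [e1] at h1
      calc |Gk n a p q| * |AX n a q r|
          ≤ (2 / min 2 a * Real.exp (-(deltaU d a / ((n : ℝ) + 1) * dist p q)))
              * (c0 d n a * Real.exp (-(1 * dist q r))) :=
            mul_le_mul h1 h2 (abs_nonneg _) (by
              have : 0 < 2 / min 2 a := div_pos two_pos (lt_min two_pos ha); positivity)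
        _ = 2 / min 2 a * c0 d n a * Real.exp (-(deltaU d a / ((n : ℝ) + 1) * dist p q))
              * Real.exp (-(1 * dist q r)) := by ring)
  have hrow : ∀ q : X d, ∑' r : X d, AX n a q r = a := tsum_AX_row n a
  simp only [hrow] at hswap
  simp_rw [tsum_Gk_mul_AX n ha] at hswap
  have hδ : ∑' r : X d, (if p = r then (1 : ℝ) else 0) = 1 := by
    rw [tsum_eq_single p (fun r hr => if_neg (Ne.symm hr)), if_pos rfl]
  -- `hswap : Σ_q G'(p,q) · a = 1`
  rw [hδ, tsum_mul_right] at hswap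
  exact (eq_div_iff ha.ne').2 hswap

/-- **`(Q'G'Q'*)·1 = a⁻¹`**: the row sums of `Q'G'Q'*` on the unit lattice equal `1/a`. [folklore] -/
theorem tsum_kerQGQ_row (n : ℕ) {a : ℝ} (ha : 0 < a) (z : X d) : ∑' y : X d, kerQGQ n a z y = 1 / a := by
  have hn : (0 : ℝ) < ((n : ℝ) + 1) ^ d := by positivity
  have hrow : ∀ p : X d, ∑' y : X d, ∑ q ∈ B n y, Gk n a p q = 1 / a := fun p => by
    rw [tsum_blocks n (summable_Gk_row n ha p), tsum_Gk_row n ha p]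
  have hs : ∀ p : X d, Summable fun y : X d => ∑ q ∈ B n y, Gk n a p q := fun p =>
    summable_blocks n (summable_Gk_row n ha p)
  have hG : ∀ y : X d, kerQGQ n a z y = (((n : ℝ) + 1) ^ d)⁻¹ * ∑ p ∈ B n z, ∑ q ∈ B n y, Gk n a p q := by
    intro y
    unfold kerQGQ
    congr 1
  simp_rw [hG]
  rw [tsum_mul_left, Summable.tsum_finsetSum (fun p _ => hs p)]
  simp_rw [hrow]
  rw [sum_B_const]
  field_simp

/-- `(Q'G'Q'*)⁻¹(Q'G'Q'*) = I` on the unit lattice, entrywise with the series over the middle index. [folklore] -/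
theorem tsum_Kinv_mul_kerQGQ (n : ℕ) {a : ℝ} (ha : 0 < a) (y' z : X d) :
    ∑' y : X d, Kinv n a y' y * kerQGQ n a y z = if y' = z then 1 else 0 := by
  have h2 : ∀ y : X d, Kinv n a y' y * kerQGQ n a y z
      = limInv Set.univ (KerQGQ n a) (toK y') (toK y) * KerQGQ n a (toK y) (toK z) := fun y => rfl
  simp_rw [h2]
  rw [Equiv.tsum_eq (toK (d := d)) (fun q' => limInv Set.univ (KerQGQ n a) (toK y') q' * KerQGQ n a q' (toK z))]
  rw [tsum_limInv_mul (gammaQ_pos d ha) (cU_pos d ha) (deltaU_pos d ha) (hyp56Z_KerQGQ_unif n ha)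
    (Set.mem_univ _) (Set.mem_univ _)]
  simp [toK, Prod.ext_iff]

/-- **`(Q'G'Q'*)⁻¹·1 = a`**: the row sums of `(Q'G'Q'*)⁻¹` equal `a`. [folklore] -/
theorem tsum_Kinv_row (n : ℕ) {a : ℝ} (ha : 0 < a) (y' : X d) : ∑' y : X d, Kinv n a y' y = a := by
  -- `a⁻¹ Σ_y K⁻¹(y',y) = Σ_y K⁻¹(y',y) Σ_z K(y,z) = Σ_z Σ_y K⁻¹(y',y)K(y,z) = Σ_z δ_{y'z} = 1`
  have hswap := tsum_mul_tsum_comm (f := fun y => Kinv n a y' y) (g := fun y z => kerQGQ n a y z)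
    (C := cInv d a * cU d a) (deltaInv_pos d ha) (deltaU_pos d ha) y' (fun y z => by
      rw [abs_mul]
      have h1 := abs_Kinv_le n ha y' y
      have h2 := abs_kerQGQ_le_unif n ha y z
      calc |Kinv n a y' y| * |kerQGQ n a y z|
          ≤ (cInv d a * Real.exp (-(deltaInv d a * dist y' y))) * (cU d a * Real.exp (-(deltaU d a * dist y z))) :=
            mul_le_mul h1 h2 (abs_nonneg _) (by have := cInv_pos d ha; positivity)
        _ = cInv d a * cU d a * Real.exp (-(deltaInv d a * dist y' y)) * Real.exp (-(deltaU d a * dist y z)) := by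
            ring)
  have hrow : ∀ y : X d, ∑' z : X d, kerQGQ n a y z = 1 / a := tsum_kerQGQ_row n ha
  simp only [hrow] at hswap
  simp_rw [tsum_Kinv_mul_kerQGQ n ha] at hswap
  have hδ : ∑' z : X d, (if y' = z then (1 : ℝ) else 0) = 1 := by
    rw [tsum_eq_single y' (fun z hz => if_neg (Ne.symm hz)), if_pos rfl]
  rw [hδ, tsum_mul_right] at hswap
  -- `hswap : (Σ_y K⁻¹(y',y)) · (1/a) = 1`
  field_simp at hswap
  linarith

/-- The rows of `G'Q'*` are summable over the blocks. [folklore] -/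
theorem summable_gq_row (n : ℕ) {a : ℝ} (ha : 0 < a) (p : X d) : Summable fun y' : X d => gq n a p y' :=
  summable_blocks n (summable_Gk_row n ha p)

/-- **REPRODUCTION OF CONSTANTS `H·1 = 1`**: every row of the minimizer kernel sums to one,
`Σ'_y H(p,y) = 1` for all `p ∈ ℤ^d` (the constant field `1` has block averages `1` and zero Dirichlet energy).
[folklore] -/
theorem tsum_kerH_row (n : ℕ) {a : ℝ} (ha : 0 < a) (p : X d) : ∑' y : X d, kerH n a p y = 1 := by
  -- `Σ_y H(p,y) = Σ_y Σ_{y'} (G'Q'*)(p,y')K⁻¹(y',y) = Σ_{y'} (G'Q'*)(p,y') Σ_y K⁻¹(y',y) = a Σ_{y'} (G'Q'*)(p,y') = 1`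
  have hswap := tsum_mul_tsum_comm (f := fun y' => gq n a p y') (g := fun y' y => Kinv n a y' y)
    (C := cU d a * Real.sqrt (((n : ℝ) + 1) ^ d) * cInv d a) (deltaU_pos d ha) (deltaInv_pos d ha) (blk n p)
    (fun y' y => by
      rw [abs_mul]
      have h1 := abs_gq_le n ha p y'
      have h2 := abs_Kinv_le n ha y' y
      calc |gq n a p y'| * |Kinv n a y' y|
          ≤ (cU d a * Real.sqrt (((n : ℝ) + 1) ^ d) * Real.exp (-(deltaU d a * dist (blk n p) y')))
              * (cInv d a * Real.exp (-(deltaInv d a * dist y' y))) :=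
            mul_le_mul h1 h2 (abs_nonneg _) (by have := cU_pos d ha; positivity)
        _ = cU d a * Real.sqrt (((n : ℝ) + 1) ^ d) * cInv d a * Real.exp (-(deltaU d a * dist (blk n p) y'))
              * Real.exp (-(deltaInv d a * dist y' y)) := by ring)
  have hrow : ∀ y' : X d, ∑' y : X d, Kinv n a y' y = a := tsum_Kinv_row n ha
  simp only [hrow] at hswap
  -- `hswap : Σ_{y'} (G'Q'*)(p,y') · a = Σ_y H(p,y)`
  have hH : ∑' y : X d, ∑' y' : X d, gq n a p y' * Kinv n a y' y = ∑' y : X d, kerH n a p y := rfl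
  rw [hH, tsum_mul_right] at hswap
  rw [← hswap]
  have hg : ∑' y' : X d, gq n a p y' = 1 / a := by
    show ∑' y' : X d, ∑ q ∈ B n y', Gk n a p q = 1 / a
    rw [tsum_blocks n (summable_Gk_row n ha p), tsum_Gk_row n ha p]
  rw [hg]
  field_simp

end

end Literature.MathematicalPhysics.QuantumFieldTheory.Balaban1983to89.B5Hk103ScalarZd
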